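import Literature.Computability.AlgebraicComplexity.GlobalStageStructure
import Literature.Computability.AlgebraicComplexity.MoreAsymmetricCleanup
import Literature.Computability.AlgebraicComplexity.YCompatibility
import HarnessLib

/-!
# The structure of `𝒯_ZUseful`: after the `Y`- and `Z`-compatibility and usefulness zero-outs the
tensor is a direct sum, over the triples of `𝒯_hash`, of broken copies of `𝒯*` with holes in the `Y`-
and `Z`-dimensions (Alman–Duan–Vassilevska Williams–Xu–Xu–Zhou 2025, §5.3–§5.5: Claims 5.7, 5.10,
5.12 and eq. `𝒯_ZUseful = ⊕ 𝒯_ZUseful|_{X_I Y_J Z_K}`) — proved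

Topic `Literature/Computability/AlgebraicComplexity`.  The deterministic (structural) half of the
global stage of Alman–Duan–Vassilevska Williams–Xu–Xu–Zhou, *More asymmetry yields faster matrix
multiplication* (SODA 2025, arXiv:2404.16349), §5.3–§5.5, assembled — exactly as
`GlobalStageStructure.lean` assembles VXXZ 2024, §5.3–§5.5 — from: the block triples `𝒯_hash` present
after the more asymmetric hashing (`MoreAsymmetricCleanup.lean`: only the `X`-blocks are in unique
triples), the `Y`-compatibility notions and Claim 5.7 (`YCompatibility.lean`), the `Z`-compatibility
notions and Claim 5.10 = VXXZ Claim 5.9 (`LevelTriples.lean`), and the direct-sum criterion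
(`IndependentBlocks.lean`).  For the data `D : GlobalStageData c n M` of one region (marginal types,
`α`, `β_X, β_Y, β_Z` — the paper's `β` is the tree's `γ` —, the `α`-consistent triples `𝒯α`, the
Salem–Spencer set `B`) and a seed `ω`, the level-1 blocks kept by §5.3–§5.4 are (`MoreAsym.keepX/Y/Z`):

* `X_Î`: its level-`ℓ` block `X_I` lies in a triple of `𝒯_hash` (unique, `xPresentTriples_eq_of_fst_eq`)
  and `Î` is useful for it (§5.3, first zero-out: "if `split(Î, S_{i,j,k}) ≠ β_{X,i,j,k}`, we zero out `X_Î`");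
* `Y_Ĵ`: there is a triple `T` of `𝒯_hash` through `Y_J` for which `Ĵ` is useful and which is the ONLY
  triple of `𝒯_hash` through `Y_J` with which `Ĵ` is `Y`-compatible — `Y`-compatibility zero-out I
  (typicalness; implied by usefulness, `IsUsefulFor.isTypicalY`), II ("given any `Y_Ĵ` that is
  compatible with more than one triple, we zero it out") and the `Y`-usefulness zero-out (§5.3.1–5.3.3);
* `Z_K̂`: the same with `Z`-compatibility (§5.4.1–5.4.3, identical to VXXZ 2024).

With `MoreAsym.finalTensor` (the paper's `𝒯_ZUseful`) the resulting zero-out of `(CW_q^{⊗c})^{⊗n}`,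
this file PROVES:

* `MoreAsym.respectsAssignment` — **level-1-independence** (§5.5: "the `X`-blocks are level-`ℓ`-independent
  after the zero-out in the asymmetric hashing step; for `Y`- and `Z`-blocks, by Claims 5.7 and 5.10, each
  level-1 block is compatible with all the level-`ℓ` triples containing it, and we zeroed out all level-1
  `Y`- and `Z`-blocks that are compatible with multiple level-`ℓ` triples"): every non-zero entry all three
  of whose blocks are kept has them assigned to ONE triple of `𝒯_hash` — the `X`-block determines the
  triple by the hashing, the `Y`-block by **Claim 5.7** (`advxxz2025_claim57`, under Remark 5.2's
  convention `β_{Y,i,j,0}(L) = β_{X,i,j,0}(2⃗ − L)`), the `Z`-block by **Claim 5.10**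
  (`compatible_fst_of_useful`, under `β_{Z,i,0,k}(L) = β_{X,i,0,k}(2⃗ − L)`, `β_{Z,0,j,k}(L) = β_{Y,0,j,k}(2⃗ − L)`);
* `MoreAsym.finalTensor_restrictsTo_directSum` / `directSum_restrictsTo_finalTensor` —
  **`𝒯_ZUseful ≅ ⊕_{T ∈ 𝒯_hash} 𝒯_ZUseful|_{X_I Y_J Z_K}`** (eq. (direct sum) of §5.5, restrictions both ways);
* `MoreAsym.summand_eq_brokenCopy` — **Claim 5.12**: the summand of `T = X_I Y_J Z_K` is the useful
  sub-tensor `𝒯*_T` (`usefulSubtensor` = the level-`ℓ` interface tensor `𝒯*`, `usefulSubtensor_eq_interfaceTensor`)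
  with exactly the following variables missing: the level-1 `Y`-blocks useful for `T` but `Y`-compatible
  with another triple of `𝒯_hash` through `Y_J` (`holesY T`) and the level-1 `Z`-blocks useful for `T` but
  compatible with another triple through `Z_K` (`holesZ T`) — a broken copy of `𝒯*` with holes in the
  `Y`- and `Z`-dimensions.

(As in `GlobalStageStructure.lean`, level-1 blocks of kept level-`ℓ` blocks lying in no triple of `𝒯_hash`,
resp. compatible with none, carry only zero entries; zeroing them as well, as the predicates do, does not
change the tensor.)  Everything is proved; the definitions are the zero-out predicates, the holes and the
assignment; no named facts.

## References

* J. Alman, R. Duan, V. Vassilevska Williams, Y. Xu, Z. Xu, R. Zhou, *More asymmetry yields faster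
  matrix multiplication*, SODA 2025, arXiv:2404.16349 (held: `paper:arxiv-2404.16349`, chunks
  p0016–p0019): §5.2 (`𝒯_hash`), §5.3 (the zero-outs, Def. 5.6, Claim 5.7, Def. 5.8), §5.4 (Defs. 5.9,
  5.11, Claim 5.10), §5.5 (Claim 5.12, the direct-sum decomposition), Remark 5.2.
  [AlmanDuanVassilevskaWilliamsXuXuZhou2025]
* V. Vassilevska Williams, Y. Xu, Z. Xu, R. Zhou, *New bounds for matrix multiplication: from alpha
  to omega*, SODA 2024, arXiv:2307.07970, §5.3–§5.5 (the original, `Z`-holes only).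
  [VassilevskaWilliamsXuXuZhou2024]
-/

noncomputable section

open scoped BigOperators
open Finset

namespace Literature.Computability.AlgebraicComplexity

open Literature.Barriers.MatrixMultiplication (bigCwTensor)

universe u

namespace GlobalStageData

open scoped Classical

variable {c n M : ℕ} (D : GlobalStageData c n M)

/-- **The block triples of `𝒯_hash`** (present after the more asymmetric hashing with seed `ω`).
[cite: AlmanDuanVassilevskaWilliamsXuXuZhou2025, §5.2] -/
abbrev hashTriples (ω : VxxzSeed M n) :
    Finset ((Fin n → Fin (2 * c + 1)) × (Fin n → Fin (2 * c + 1)) × (Fin n → Fin (2 * c + 1))) :=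
  xPresentTriples (2 * c) D.tripleSet D.𝒯α ω D.B

/-- `Y`-compatibility of a level-1 `Y`-sequence with a block triple (Def. 5.6). [cite: AlmanDuanVassilevskaWilliamsXuXuZhou2025, Def. 5.6] -/
abbrev YCompatible (T : (Fin n → Fin (2 * c + 1)) × (Fin n → Fin (2 * c + 1)) × (Fin n → Fin (2 * c + 1)))
    (Jh : Fin n → Fin c → Fin 3) : Prop :=
  IsYCompatibleWith c D.α D.γY (seqVal T.1) (seqVal T.2.1) (seqVal T.2.2) Jh

namespace MoreAsym

/-! ### The level-1 blocks kept by the zero-outs of §5.3–§5.4 -/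

/-- **`X_Î` is kept**: its level-`ℓ` block lies in a triple of `𝒯_hash` for which `Î` is useful (the first
zero-out of §5.3). [cite: AlmanDuanVassilevskaWilliamsXuXuZhou2025, §5.3 ("if split(Î, S_{i,j,k}) ≠ β_{X,i,j,k}, we zero out X_Î")] -/
def keepX (ω : VxxzSeed M n) (Ih : Fin n → Fin c → Fin 3) : Prop :=
  ∃ T ∈ D.hashTriples ω, T.1 = blockOfSeq Ih ∧ D.UsefulX T Ih

/-- **`Y_Ĵ` is kept**: there is a triple of `𝒯_hash` through `Y_J` for which `Ĵ` is useful and which is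
the only triple of `𝒯_hash` through `Y_J` with which `Ĵ` is `Y`-compatible (`Y`-compatibility zero-outs
I–II and the `Y`-usefulness zero-out). [cite: AlmanDuanVassilevskaWilliamsXuXuZhou2025, §5.3.1–§5.3.3] -/
def keepY (ω : VxxzSeed M n) (Jh : Fin n → Fin c → Fin 3) : Prop :=
  ∃ T ∈ D.hashTriples ω, T.2.1 = blockOfSeq Jh ∧ D.UsefulY T Jh ∧
    ∀ T' ∈ D.hashTriples ω, T'.2.1 = blockOfSeq Jh → D.YCompatible T' Jh → T' = T

/-- **`Z_K̂` is kept**: there is a triple of `𝒯_hash` through `Z_K` for which `K̂` is useful and which is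
the only triple of `𝒯_hash` through `Z_K` compatible with `K̂` (`Z`-compatibility zero-outs I–II and the
`Z`-usefulness zero-out). [cite: AlmanDuanVassilevskaWilliamsXuXuZhou2025, §5.4.1–§5.4.3] -/
def keepZ (ω : VxxzSeed M n) (Kh : Fin n → Fin c → Fin 3) : Prop :=
  ∃ T ∈ D.hashTriples ω, T.2.2 = blockOfSeq Kh ∧ D.UsefulZ T Kh ∧
    ∀ T' ∈ D.hashTriples ω, T'.2.2 = blockOfSeq Kh → D.Compatible T' Kh → T' = T

/-- **The `Y`-holes of the copy over `T`**: the level-1 `Y`-blocks useful for `T` that are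
`Y`-compatible with another triple of `𝒯_hash` through `Y_J` (zeroed out in zero-out II).
[cite: AlmanDuanVassilevskaWilliamsXuXuZhou2025, Claim 5.12 ("the missing variables … are exactly those level-1 blocks Y_Ĵ that are compatible with multiple level-ℓ triples in 𝒯_YComp …")] -/
def holesY (ω : VxxzSeed M n) (T : (Fin n → Fin (2 * c + 1)) × (Fin n → Fin (2 * c + 1)) × (Fin n → Fin (2 * c + 1))) :
    Finset (Fin n → Fin c → Fin 3) :=
  univ.filter fun Jh => blockOfSeq Jh = T.2.1 ∧ D.UsefulY T Jh ∧
    ∃ T' ∈ D.hashTriples ω, T' ≠ T ∧ T'.2.1 = T.2.1 ∧ D.YCompatible T' Jh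

/-- **The `Z`-holes of the copy over `T`**: the level-1 `Z`-blocks useful for `T` that are compatible
with another triple of `𝒯_hash` through `Z_K`. [cite: AlmanDuanVassilevskaWilliamsXuXuZhou2025, Claim 5.12 ("… and level-1 blocks Z_K̂ that are compatible with multiple level-ℓ triples in 𝒯_ZComp")] -/
def holesZ (ω : VxxzSeed M n) (T : (Fin n → Fin (2 * c + 1)) × (Fin n → Fin (2 * c + 1)) × (Fin n → Fin (2 * c + 1))) :
    Finset (Fin n → Fin c → Fin 3) :=
  univ.filter fun Kh => blockOfSeq Kh = T.2.2 ∧ D.UsefulZ T Kh ∧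
    ∃ T' ∈ D.hashTriples ω, T' ≠ T ∧ T'.2.2 = T.2.2 ∧ D.Compatible T' Kh

variable (R : Type u) [CommSemiring R] (q : ℕ)

/-- **`𝒯_ZUseful`**: the zero-out of `(CW_q^{⊗c})^{⊗n}` keeping the level-1 blocks kept by §5.2–§5.4.
[cite: AlmanDuanVassilevskaWilliamsXuXuZhou2025, §5.4.3 ("call the remaining tensor 𝒯_ZUseful")] -/
def finalTensor (ω : VxxzSeed M n) :
    (Fin n → Fin c → Fin (q + 2)) → (Fin n → Fin c → Fin (q + 2)) → (Fin n → Fin c → Fin (q + 2)) → R :=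
  partSubtensor levelSeq levelSeq levelSeq (kroneckerPow (kroneckerPow (bigCwTensor R q) c) n)
    (univ.filter (keepX D ω)) (univ.filter (keepY D ω)) (univ.filter (keepZ D ω))

/-! ### The assignment of the kept level-1 blocks to the triples of `𝒯_hash` -/

/-- The triple of a kept level-1 `X`-block (`none` if not kept). [cite: AlmanDuanVassilevskaWilliamsXuXuZhou2025, §5.5 (level-1-independence)] -/
def assignX (ω : VxxzSeed M n) (Ih : Fin n → Fin c → Fin 3) : Option ↥(D.hashTriples ω) :=
  if h : keepX D ω Ih then some ⟨h.choose, h.choose_spec.1⟩ else none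

/-- The triple of a kept level-1 `Y`-block (the unique `Y`-compatible one). [cite: AlmanDuanVassilevskaWilliamsXuXuZhou2025, §5.3.2 and §5.5] -/
def assignY (ω : VxxzSeed M n) (Jh : Fin n → Fin c → Fin 3) : Option ↥(D.hashTriples ω) :=
  if h : keepY D ω Jh then some ⟨h.choose, h.choose_spec.1⟩ else none

/-- The triple of a kept level-1 `Z`-block (the unique compatible one). [cite: AlmanDuanVassilevskaWilliamsXuXuZhou2025, §5.4.2 and §5.5] -/
def assignZ (ω : VxxzSeed M n) (Kh : Fin n → Fin c → Fin 3) : Option ↥(D.hashTriples ω) :=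
  if h : keepZ D ω Kh then some ⟨h.choose, h.choose_spec.1⟩ else none

variable {D R q}

/-- Triples of `𝒯_hash` are `α`-consistent block triples. [cite: AlmanDuanVassilevskaWilliamsXuXuZhou2025, §5.2] -/
theorem hashTriples_good (hD : D.WellFormed) {ω : VxxzSeed M n}
    {T : (Fin n → Fin (2 * c + 1)) × (Fin n → Fin (2 * c + 1)) × (Fin n → Fin (2 * c + 1))}
    (hT : T ∈ D.hashTriples ω) :
    IsLevelTriple c (seqVal T.1) (seqVal T.2.1) (seqVal T.2.2) ∧
      IsAlphaConsistent D.α (seqVal T.1) (seqVal T.2.1) (seqVal T.2.2) :=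
  ⟨isLevelTriple_of_mem_tripleSet (hD.subset (xPresentTriples_subset hT)),
    hD.alphaConsistent T (xPresentTriples_subset hT)⟩

/-- `assignX Î = T` iff `X_Î ⊆ X_{T.1}` and `Î` is useful for the triple `T` of `𝒯_hash` (the triple of
`𝒯_hash` through an `X`-block is unique). [cite: AlmanDuanVassilevskaWilliamsXuXuZhou2025, §5.2–§5.3] -/
theorem assignX_eq_some_iff {ω : VxxzSeed M n} {Ih : Fin n → Fin c → Fin 3} {T : ↥(D.hashTriples ω)} :
    assignX D ω Ih = some T ↔ T.1.1 = blockOfSeq Ih ∧ D.UsefulX T.1 Ih := by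
  unfold assignX
  split_ifs with h
  · have hc := h.choose_spec
    constructor
    · intro he
      have he' := Subtype.ext_iff.1 (Option.some_injective _ he)
      simp only at he'
      rw [← he']
      exact ⟨hc.2.1, hc.2.2⟩
    · rintro ⟨h1, hu⟩
      congr 1
      apply Subtype.ext
      exact xPresentTriples_eq_of_fst_eq hc.1 T.2 (hc.2.1.trans h1.symm)
  · constructor
    · intro he; exact absurd he (by simp)
    · rintro ⟨h1, hu⟩
      exact absurd ⟨T.1, T.2, h1, hu⟩ h

/-- `assignY Ĵ = T` iff `Y_Ĵ ⊆ Y_{T.2.1}`, `Ĵ` is useful for `T`, and `T` is the only triple of `𝒯_hash`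
through `Y_J` with which `Ĵ` is `Y`-compatible. [cite: AlmanDuanVassilevskaWilliamsXuXuZhou2025, §5.3.2–§5.3.3] -/
theorem assignY_eq_some_iff (hD : D.WellFormed) {ω : VxxzSeed M n} {Jh : Fin n → Fin c → Fin 3}
    {T : ↥(D.hashTriples ω)} :
    assignY D ω Jh = some T ↔ T.1.2.1 = blockOfSeq Jh ∧ D.UsefulY T.1 Jh ∧
      ∀ T' ∈ D.hashTriples ω, T'.2.1 = blockOfSeq Jh → D.YCompatible T' Jh → T' = T.1 := by
  unfold assignY
  split_ifs with h
  · have hc := h.choose_spec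
    constructor
    · intro he
      have he' := Subtype.ext_iff.1 (Option.some_injective _ he)
      simp only at he'
      rw [← he']
      exact ⟨hc.2.1, hc.2.2.1, hc.2.2.2⟩
    · rintro ⟨h1, hu, huniq⟩
      have hg := hashTriples_good hD hc.1
      have hcompat : D.YCompatible h.choose Jh := IsUsefulFor.isYCompatibleWith hg.1 hg.2 hc.2.2.1
      have heq : h.choose = T.1 := huniq _ hc.1 hc.2.1 hcompat
      congr 1
      exact Subtype.ext heq
  · constructor
    · intro he; exact absurd he (by simp)
    · rintro ⟨h1, hu, huniq⟩
      exact absurd ⟨T.1, T.2, h1, hu, huniq⟩ h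

/-- `assignZ K̂ = T` iff `Z_K̂ ⊆ Z_{T.2.2}`, `K̂` is useful for `T`, and `T` is the only triple of `𝒯_hash`
through `Z_K` compatible with `K̂`. [cite: AlmanDuanVassilevskaWilliamsXuXuZhou2025, §5.4.2–§5.4.3] -/
theorem assignZ_eq_some_iff (hD : D.WellFormed) {ω : VxxzSeed M n} {Kh : Fin n → Fin c → Fin 3}
    {T : ↥(D.hashTriples ω)} :
    assignZ D ω Kh = some T ↔ T.1.2.2 = blockOfSeq Kh ∧ D.UsefulZ T.1 Kh ∧
      ∀ T' ∈ D.hashTriples ω, T'.2.2 = blockOfSeq Kh → D.Compatible T' Kh → T' = T.1 := by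
  unfold assignZ
  split_ifs with h
  · have hc := h.choose_spec
    constructor
    · intro he
      have he' := Subtype.ext_iff.1 (Option.some_injective _ he)
      simp only at he'
      rw [← he']
      exact ⟨hc.2.1, hc.2.2.1, hc.2.2.2⟩
    · rintro ⟨h1, hu, huniq⟩
      have hg := hashTriples_good hD hc.1
      have hcompat : D.Compatible h.choose Kh := IsUsefulFor.isCompatibleWith hg.1 hg.2 hc.2.2.1
      have heq : h.choose = T.1 := huniq _ hc.1 hc.2.1 hcompat
      congr 1
      exact Subtype.ext heq
  · constructor
    · intro he; exact absurd he (by simp)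
    · rintro ⟨h1, hu, huniq⟩
      exact absurd ⟨T.1, T.2, h1, hu, huniq⟩ h

/-! ### Level-1-independence (Claims 5.7, 5.10 and the uniqueness of the triples of `𝒯_hash`) -/

/-- **The standing hypotheses on the data** for the more asymmetric global stage: those of
`GlobalStageData.WellFormed` (`𝒯α ⊆ 𝒯` consists of `α`-consistent triples; Remark 5.2 for `β_Z`) and
Remark 5.2's third convention, `β_{Y,i,j,0}(L) = β_{X,i,j,0}(2⃗ − L)`, used by Claim 5.7.
[cite: AlmanDuanVassilevskaWilliamsXuXuZhou2025, Remark 5.2] -/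
structure WellFormed (D : GlobalStageData c n M) : Prop extends D.WellFormed where
  /-- Remark 5.2: `β_{Y,i,j,0}(L) = β_{X,i,j,0}(2⃗ − L)` -/
  revXY : ∀ i j σ, D.γY (i, j, 0) σ = D.γX (i, j, 0) (fun p => (σ p).rev)

/-- **Level-1-independence of `𝒯_ZUseful`** (§5.5): with the kept level-1 blocks assigned to their
triples of `𝒯_hash`, every non-zero entry of the power all three of whose blocks are kept has them in ONE
triple.  The `X`-block determines the triple by the hashing; for the `Y`-block this is **Claim 5.7**
(`Ĵ` is `Y`-compatible with the triple of `Î`, `advxxz2025_claim57`) with the uniqueness recorded in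
`keepY`; for the `Z`-block **Claim 5.10** (`compatible_fst_of_useful`) with the uniqueness in `keepZ`.
[cite: AlmanDuanVassilevskaWilliamsXuXuZhou2025, §5.5 ("𝒯_ZUseful|_{X_I Y_J Z_K} is level-1-independent for different block triples"), Claims 5.7 and 5.10] -/
theorem respectsAssignment (hD : WellFormed D) (R : Type u) [CommSemiring R] (q : ℕ) (ω : VxxzSeed M n) :
    RespectsAssignment levelSeq levelSeq levelSeq (kroneckerPow (kroneckerPow (bigCwTensor R q) c) n)
      (assignX D ω) (assignY D ω) (assignZ D ω) := by
  intro x y z T₁ T₂ T₃ hne h1 h2 h3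
  rw [assignX_eq_some_iff] at h1
  rw [assignY_eq_some_iff hD.toWellFormed] at h2
  rw [assignZ_eq_some_iff hD.toWellFormed] at h3
  obtain ⟨hI, huX⟩ := h1
  obtain ⟨hJ, huY, huniqY⟩ := h2
  obtain ⟨hK, huZ, huniqZ⟩ := h3
  -- the block triple `T₀ = (I, J, K)` of the entry is a hash-present triple of `𝒯`
  obtain ⟨hT₁𝒯, hT₁x, -, -⟩ := mem_xPresentTriples.1 T₁.2
  obtain ⟨hT₂𝒯, -, hT₂y, -⟩ := mem_xPresentTriples.1 T₂.2
  obtain ⟨hT₃𝒯, -, -, hT₃z⟩ := mem_xPresentTriples.1 T₃.2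
  have hμ₁ := (mem_typedSupport.1 hT₁𝒯).1
  have hμ₂ := (mem_typedSupport.1 hT₂𝒯).2.1
  have hμ₃ := (mem_typedSupport.1 hT₃𝒯).2.2.1
  rw [hI] at hμ₁ hT₁x
  rw [hJ] at hμ₂ hT₂y
  rw [hK] at hμ₃ hT₃z
  have hT₀ : (blockOfSeq (levelSeq x), blockOfSeq (levelSeq y), blockOfSeq (levelSeq z)) ∈ D.tripleSet :=
    blockTriple_mem_tripleSet R q hne hμ₁ hμ₂ hμ₃
  have hT₀p : (blockOfSeq (levelSeq x), blockOfSeq (levelSeq y), blockOfSeq (levelSeq z)) ∈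
      hashPresent (2 * c) D.tripleSet ω D.B :=
    mem_hashPresent.2 ⟨hT₀, (mem_keptX.1 hT₁x).2.1, (mem_xKeptY.1 hT₂y).2, (mem_keptZ.1 hT₃z).2⟩
  -- `T₁ = T₀` by the uniqueness of hash-present triples through a kept `X`-block
  have e₁ : T₁.1 = (blockOfSeq (levelSeq x), blockOfSeq (levelSeq y), blockOfSeq (levelSeq z)) :=
    hashPresent_unique_of_mem_keptX hT₁x (hashPresent_of_mem_xPresentTriples T₁.2) hT₀p hI rfl
  have hT₀h : (blockOfSeq (levelSeq x), blockOfSeq (levelSeq y), blockOfSeq (levelSeq z)) ∈ D.hashTriples ω :=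
    e₁ ▸ T₁.2
  have hg₀ := hashTriples_good hD.toWellFormed hT₀h
  have huX' : IsUsefulFor D.γX (chunkLevels (levelSeq x)) (chunkLevels (levelSeq y)) (chunkLevels (levelSeq z))
      (levelSeq x) := by
    have := huX; rw [e₁] at this; simpa [chunkLevels_eq_seqVal_blockOfSeq] using this
  -- `T₂ = T₀` by Claim 5.7: `Ĵ` is `Y`-compatible with `T₀` (and typical, being useful for `T₂`)
  have hg₂ := hashTriples_good hD.toWellFormed T₂.2
  have htypY : IsTypicalY c D.α D.γY (chunkLevels (levelSeq y)) (levelSeq y) := by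
    have := IsUsefulFor.isTypicalY hg₂.1 hg₂.2 huY
    rw [hJ] at this
    simpa [chunkLevels_eq_seqVal_blockOfSeq] using this
  have hcompatY : D.YCompatible (blockOfSeq (levelSeq x), blockOfSeq (levelSeq y), blockOfSeq (levelSeq z))
      (levelSeq y) := by
    have := advxxz2025_claim57 R q (α := D.α) hD.revXY hne huX' htypY
    simpa [chunkLevels_eq_seqVal_blockOfSeq] using this
  have e₂ : (blockOfSeq (levelSeq x), blockOfSeq (levelSeq y), blockOfSeq (levelSeq z)) = T₂.1 :=
    huniqY _ hT₀h rfl hcompatY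
  have h12 : T₁ = T₂ := Subtype.ext (e₁.trans e₂)
  -- `T₃ = T₀` by Claim 5.10: `K̂` is compatible with `T₀`
  have huY' : IsUsefulFor D.γY (chunkLevels (levelSeq x)) (chunkLevels (levelSeq y)) (chunkLevels (levelSeq z))
      (levelSeq y) := by
    have := huY; rw [← e₂] at this; simpa [chunkLevels_eq_seqVal_blockOfSeq] using this
  have hcompatZ : D.Compatible (blockOfSeq (levelSeq x), blockOfSeq (levelSeq y), blockOfSeq (levelSeq z))
      (levelSeq z) := by
    refine ⟨fun i j k hij hne' => ?_, ?_⟩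
    · have := compatible_fst_of_useful R q hD.revX hD.revY hne huX' huY' i j k hij
        (by simpa [chunkLevels_eq_seqVal_blockOfSeq] using hne')
      simpa [chunkLevels_eq_seqVal_blockOfSeq] using this
    · have hg₃ := hashTriples_good hD.toWellFormed T₃.2
      have htyp := IsUsefulFor.isTypical hg₃.1 hg₃.2 huZ
      rw [hK] at htyp
      exact htyp
  have e₃ : (blockOfSeq (levelSeq x), blockOfSeq (levelSeq y), blockOfSeq (levelSeq z)) = T₃.1 :=
    huniqZ _ hT₀h rfl hcompatZ
  exact ⟨h12, Subtype.ext (e₂.symm.trans e₃)⟩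

/-! ### The tensor is the direct sum of its restrictions to the triples of `𝒯_hash` -/

/-- The kept parts of the assignment are the kept level-1 blocks. [folklore] -/
theorem keptParts_assignX (ω : VxxzSeed M n) : keptParts (assignX D ω) = univ.filter (keepX D ω) := by
  ext Ih
  rw [mem_keptParts, mem_filter]
  simp only [mem_univ, true_and, assignX]
  split_ifs with h <;> simp [h]

/-- The kept parts of the assignment are the kept level-1 blocks. [folklore] -/
theorem keptParts_assignY (ω : VxxzSeed M n) : keptParts (assignY D ω) = univ.filter (keepY D ω) := by
  ext Jh
  rw [mem_keptParts, mem_filter]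
  simp only [mem_univ, true_and, assignY]
  split_ifs with h <;> simp [h]

/-- The kept parts of the assignment are the kept level-1 blocks. [folklore] -/
theorem keptParts_assignZ (ω : VxxzSeed M n) : keptParts (assignZ D ω) = univ.filter (keepZ D ω) := by
  ext Kh
  rw [mem_keptParts, mem_filter]
  simp only [mem_univ, true_and, assignZ]
  split_ifs with h <;> simp [h]

variable (D R q)

/-- **The summand of `𝒯_ZUseful` over the triple `T` of `𝒯_hash`**: the sub-tensor of the power over the
level-1 blocks assigned to `T`. [cite: AlmanDuanVassilevskaWilliamsXuXuZhou2025, §5.5 (𝒯_ZUseful|_{X_I Y_J Z_K})] -/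
def summand (ω : VxxzSeed M n) (T : ↥(D.hashTriples ω)) :
    (Fin n → Fin c → Fin (q + 2)) → (Fin n → Fin c → Fin (q + 2)) → (Fin n → Fin c → Fin (q + 2)) → R :=
  partSubtensor levelSeq levelSeq levelSeq (kroneckerPow (kroneckerPow (bigCwTensor R q) c) n)
    (assignedParts (assignX D ω) T) (assignedParts (assignY D ω) T) (assignedParts (assignZ D ω) T)

variable {D}

/-- `𝒯_ZUseful` as the kept tensor of the assignment. [folklore] -/
theorem finalTensor_eq (ω : VxxzSeed M n) :
    finalTensor D R q ω = partSubtensor levelSeq levelSeq levelSeq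
      (kroneckerPow (kroneckerPow (bigCwTensor R q) c) n)
      (keptParts (assignX D ω)) (keptParts (assignY D ω)) (keptParts (assignZ D ω)) := by
  rw [keptParts_assignX, keptParts_assignY, keptParts_assignZ, finalTensor]

/-- **`𝒯_ZUseful ≥ ⊕_{T ∈ 𝒯_hash} (summand T)`.** [cite: AlmanDuanVassilevskaWilliamsXuXuZhou2025, §5.5 (eq. 𝒯_ZUseful = ⊕ 𝒯_ZUseful|_{X_I Y_J Z_K})] -/
theorem finalTensor_restrictsTo_directSum (hD : WellFormed D) (ω : VxxzSeed M n) :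
    TensorRestrictsTo (finalTensor D R q ω) (familyDirectSum fun T : ↥(D.hashTriples ω) => summand D R q ω T) := by
  rw [finalTensor_eq]
  exact partSubtensor_kept_restrictsTo_familyDirectSum _ (respectsAssignment hD R q ω)

/-- **`⊕_{T ∈ 𝒯_hash} (summand T) ≥ 𝒯_ZUseful`** (so the two are isomorphic). [cite: AlmanDuanVassilevskaWilliamsXuXuZhou2025, §5.5] -/
theorem directSum_restrictsTo_finalTensor (hD : WellFormed D) (ω : VxxzSeed M n) :
    TensorRestrictsTo (familyDirectSum fun T : ↥(D.hashTriples ω) => summand D R q ω T) (finalTensor D R q ω) := by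
  rw [finalTensor_eq]
  exact familyDirectSum_restrictsTo_partSubtensor_kept _ (respectsAssignment hD R q ω)

/-! ### Claim 5.12: each summand is a broken copy of `𝒯*` with holes in the `Y`- and `Z`-dimensions -/

/-- The `X`-parts assigned to `T`: the level-1 `X`-sequences in `X_I` useful for `T` (no `X`-holes).
[cite: AlmanDuanVassilevskaWilliamsXuXuZhou2025, Claim 5.12 (proof, item 1)] -/
theorem assignedParts_assignX {ω : VxxzSeed M n} (T : ↥(D.hashTriples ω)) :
    assignedParts (assignX D ω) T = univ.filter fun Ih => blockOfSeq Ih = T.1.1 ∧ D.UsefulX T.1 Ih := by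
  ext Ih
  rw [mem_assignedParts, assignX_eq_some_iff, mem_filter]
  simp only [mem_univ, true_and]
  exact ⟨fun h => ⟨h.1.symm, h.2⟩, fun h => ⟨h.1.symm, h.2⟩⟩

/-- The `Y`-parts assigned to `T`: useful for `T` and NOT a `Y`-hole. [cite: AlmanDuanVassilevskaWilliamsXuXuZhou2025, Claim 5.12 (the missing Y variables)] -/
theorem assignedParts_assignY (hD : D.WellFormed) {ω : VxxzSeed M n} (T : ↥(D.hashTriples ω)) :
    assignedParts (assignY D ω) T =
      (univ.filter fun Jh => blockOfSeq Jh = T.1.2.1 ∧ D.UsefulY T.1 Jh) \ holesY D ω T.1 := by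
  ext Jh
  rw [mem_assignedParts, assignY_eq_some_iff hD, mem_sdiff, mem_filter, holesY, mem_filter]
  simp only [mem_univ, true_and]
  constructor
  · rintro ⟨h1, hu, huniq⟩
    refine ⟨⟨h1.symm, hu⟩, ?_⟩
    rintro ⟨-, -, T', hT', hne, h2, hc⟩
    exact hne (huniq T' hT' (h2.trans h1) hc)
  · rintro ⟨⟨h1, hu⟩, hnot⟩
    refine ⟨h1.symm, hu, fun T' hT' h2 hc => ?_⟩
    by_contra hne
    exact hnot ⟨h1, hu, T', hT', hne, h2.trans h1, hc⟩

/-- The `Z`-parts assigned to `T`: useful for `T` and NOT a `Z`-hole. [cite: AlmanDuanVassilevskaWilliamsXuXuZhou2025, Claim 5.12 (the missing Z variables)] -/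
theorem assignedParts_assignZ (hD : D.WellFormed) {ω : VxxzSeed M n} (T : ↥(D.hashTriples ω)) :
    assignedParts (assignZ D ω) T =
      (univ.filter fun Kh => blockOfSeq Kh = T.1.2.2 ∧ D.UsefulZ T.1 Kh) \ holesZ D ω T.1 := by
  ext Kh
  rw [mem_assignedParts, assignZ_eq_some_iff hD, mem_sdiff, mem_filter, holesZ, mem_filter]
  simp only [mem_univ, true_and]
  constructor
  · rintro ⟨h1, hu, huniq⟩
    refine ⟨⟨h1.symm, hu⟩, ?_⟩
    rintro ⟨-, -, T', hT', hne, h2, hc⟩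
    exact hne (huniq T' hT' (h2.trans h1) hc)
  · rintro ⟨⟨h1, hu⟩, hnot⟩
    refine ⟨h1.symm, hu, fun T' hT' h2 hc => ?_⟩
    by_contra hne
    exact hnot ⟨h1, hu, T', hT', hne, h2.trans h1, hc⟩

/-- **ADVXXZ Claim 5.12**: the summand of `𝒯_ZUseful` over a triple `T = X_I Y_J Z_K` of `𝒯_hash` is the
useful sub-tensor `𝒯*_T` over it (`usefulSubtensor`, the level-`ℓ` interface tensor `𝒯*` read on the
chunks of `T`, `usefulSubtensor_eq_interfaceTensor`) with exactly the `Y`-holes `holesY T` and the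
`Z`-holes `holesZ T` zeroed out: "the subtensor of `𝒯_ZUseful` restricted to the level-`ℓ` blocks
`X_I, Y_J, Z_K` is a subtensor of `𝒯*`, where the missing variables in this subtensor are exactly those
level-1 blocks `Y_Ĵ` that are compatible with multiple level-`ℓ` triples in `𝒯_YComp` and level-1 blocks
`Z_K̂` that are compatible with multiple level-`ℓ` triples in `𝒯_ZComp`".
[cite: AlmanDuanVassilevskaWilliamsXuXuZhou2025, Claim 5.12] -/
theorem summand_eq_brokenCopy (hD : D.WellFormed) {ω : VxxzSeed M n} (T : ↥(D.hashTriples ω)) :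
    summand D R q ω T = partSubtensor levelSeq levelSeq levelSeq
      (usefulSubtensor R q (seqVal T.1.1) (seqVal T.1.2.1) (seqVal T.1.2.2) D.γX D.γY D.γZ)
      univ (holesY D ω T.1)ᶜ (holesZ D ω T.1)ᶜ := by
  rw [summand, usefulSubtensor, partSubtensor_partSubtensor, assignedParts_assignX, assignedParts_assignY hD,
    assignedParts_assignZ hD]
  congr 1
  · ext Ih
    simp only [mem_filter, mem_univ, true_and, mem_inter, and_true, chunkLevels_eq_iff]
  · ext Jh
    simp only [mem_sdiff, mem_filter, mem_univ, true_and, mem_inter, mem_compl, chunkLevels_eq_iff]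
  · ext Kh
    simp only [mem_sdiff, mem_filter, mem_univ, true_and, mem_inter, mem_compl, chunkLevels_eq_iff]

/-- Consequently **`𝒯_ZUseful` degenerates into the direct sum of the broken copies**
`⊕_{T ∈ 𝒯_hash} (𝒯*_T)‖_{univ, (holesY T)ᶜ, (holesZ T)ᶜ}` (by restriction).
[cite: AlmanDuanVassilevskaWilliamsXuXuZhou2025, §5.5 ("is a direct sum of broken copies of 𝒯*")] -/
theorem finalTensor_restrictsTo_directSum_brokenCopies (hD : WellFormed D) (ω : VxxzSeed M n) :
    TensorRestrictsTo (finalTensor D R q ω)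
      (familyDirectSum fun T : ↥(D.hashTriples ω) => partSubtensor levelSeq levelSeq levelSeq
        (usefulSubtensor R q (seqVal T.1.1) (seqVal T.1.2.1) (seqVal T.1.2.2) D.γX D.γY D.γZ)
        univ (holesY D ω T.1)ᶜ (holesZ D ω T.1)ᶜ) := by
  have h := finalTensor_restrictsTo_directSum R q hD ω
  have e : (fun T : ↥(D.hashTriples ω) => summand D R q ω T) = fun T => partSubtensor levelSeq levelSeq levelSeq
      (usefulSubtensor R q (seqVal T.1.1) (seqVal T.1.2.1) (seqVal T.1.2.2) D.γX D.γY D.γZ)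
      univ (holesY D ω T.1)ᶜ (holesZ D ω T.1)ᶜ := funext fun T => summand_eq_brokenCopy R q hD.toWellFormed T
  rw [e] at h
  exact h

end MoreAsym

end GlobalStageData

end Literature.Computability.AlgebraicComplexity
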